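import Summits.ResolutionOfSingularities.ResolutionOfSingularities.Theorems.EquisingularLiftEquisingularLiftStrictTransformSpecialFibreTransport
import Summits.ResolutionOfSingularities.ResolutionOfSingularities.Theorems.EquisingularLiftEquisingularLiftCentreBlowupFlatExceptional
import Literature.AlgebraicGeometry.Resolution.BlowupsRelativeCartier
import Literature.AlgebraicGeometry.Resolution.BlowupsLocal
import Literature.AlgebraicGeometry.Resolution.BlowupsIntegral
import Mathlib.AlgebraicGeometry.Morphisms.ClosedImmersion
import HarnessLib

/-!
# [OURS · L1 W4.5(b) · EL♮ T-ISO-0⁺] THE MODEL STEP: a downstairs blow-up IS the special fibre of the upstairs blow-up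
# (kit K2 of res-D-pv-029's T-ISO-0⁺ «point-resolvable modulo Δ-steps lift», res-L1-w45b-plan-1 ORDERS AMENDMENT 2 (c) 2026-08-27)

Crux `EquisingularLiftNat` = stmt-ResolutionOfSingularities-20038 (route EquisingularLift), line `sections`; helper file
`--supports … --as helper`. HONEST FRAMING: OURS (cell res-hironaka, slot W4.5(b)); NOT a statement of any manuscript; AI-written,
weaker than expert review. No `sorry`; standard axioms.

WHY. T-ISO-0 (p505885) carried only an abstract isomorphism of REDUCED STRICT TRANSFORMS `V(closure T)_red ≅ V(closure S')_red`
between the downstairs tower (over `k`) and the upstairs tower (over `O`); that identifies POINT centres (`z₁ = e x`) but cannot say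
«the upstairs centre `C` has special fibre the downstairs centre `D`» for a CURVE `D`. The replacement invariant is the
**SPECIAL-FIBRE MODEL SQUARE**: the downstairs ambient `F` IS the special fibre of the upstairs ambient `X'` through a closed immersion
`j : F → X'` sitting in a cartesian square over `Spec k → Spec O`, with `j '' T = S'` on the strict-transform sets.

THE STEP (`modelStep`, device- and dimension-free). Data: a local ring `O`, a surjection `θ : O → k` whose `Spec` hits the closed point,
the base `q : P → Spec O` with the closed set `Y`, a stage predicate `Ch` closed under HORIZONTAL E1 steps (the conclusion clause of EL♮),
an upstairs stage `(X', σ', S')` with `Ch`, `X'` regular locally Noetherian; downstairs `(F, T)` with the model square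
`IsPullback j t (σ' ≫ q) (Spec θ)` and `j '' T = S'`; an upstairs centre `C` (regular, `O`-flat, off the generic point of `Y`) and a
downstairs centre `D` with **`C.comap j = D`** and `supp D ⊆ T`; blow-ups `τ : X'' → X'` along `C` and `υ : F₂ → F` along `D`. OUTPUT:
`Ch` for `(X'', τ ≫ σ', closure τ⁻¹(S' ∖ V(C)))`, `X''` regular and locally Noetherian, and a NEW MODEL SQUARE `j₂ : F₂ → X''` over
`Spec θ` with `j₂ ≫ τ = υ ≫ j` and `j₂ '' closure υ⁻¹(T ∖ V(D)) = closure τ⁻¹(S' ∖ V(C))`.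

Proof: the exceptional divisor of `τ` is `O`-flat (`flat_exceptional_of_isBlowup_regularCentre`, H1 p460210: regular `O`-flat centre of
a regular ambient), so `X'' ×_{X'} F → F` is a blow-up along `C·𝒪_F = D` (`IsBlowup.of_isPullback_of_flat_exceptional`, Stacks 0805/056P);
uniqueness of blow-ups gives `F₂ ≅ X'' ×_{X'} F` over `F`; paste the squares; the strict-transform sets agree by
`closure_preimage_diff_eq_image_pullback` (T2 file). Sections, multisections, in-carrier lines and Δ-centres are all instances (any
regular `O`-flat `C` with prescribed `C.comap j`).

References: The Stacks Project, Tags 0805, 056P, 02ND; Q. Liu, *Algebraic Geometry and Arithmetic Curves* (2002), Thm. 8.1.19;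
U. Görtz, T. Wedhorn, *Algebraic Geometry I* (2020), Def. 13.90, Prop. 13.91.
-/

set_option linter.dupNamespace false -- mandated namespace `Summit.<Summit>.<Problem>` of this single-conjunct summit

noncomputable section

open CategoryTheory CategoryTheory.Limits AlgebraicGeometry TopologicalSpace Topology
open Literature.AlgebraicGeometry.Resolution
open AlgebraicGeometry.Scheme.IdealSheafData
open Summit.ResolutionOfSingularities.ResolutionOfSingularities.Cruxes.EquisingularLift.StrataSplit

namespace Summit.ResolutionOfSingularities.ResolutionOfSingularities.Cruxes.EquisingularLiftNat.Sections

universe u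

/-! ## Small lemmas on model squares -/

/-- In a cartesian square `j ≫ r = t ≫ b`, the range of `j` is the preimage of the range of `b`. [folklore] -/
theorem range_eq_preimage_of_isPullback {F X S B : Scheme.{u}} {j : F ⟶ X} {t : F ⟶ B} {r : X ⟶ S} {b : B ⟶ S}
    (h : IsPullback j t r b) : Set.range j = r ⁻¹' Set.range b := by
  have hsurj : Function.Surjective h.isoPullback.hom := h.isoPullback.hom.homeomorph.surjective
  rw [← Scheme.Pullback.range_fst (f := r) (g := b), ← h.isoPullback_hom_fst, Scheme.Hom.comp_base, TopCat.coe_comp,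
    Set.range_comp, Set.range_eq_univ.mpr hsurj, Set.image_univ]

/-- `Spec` of a surjection onto a nonzero ring with local source hits exactly the closed point when its kernel is the
maximal ideal — the case of a surjection from a local ring onto a field. [folklore] -/
theorem range_specMap_of_surjective_of_field {O k : Type u} [CommRing O] [IsLocalRing O] [Field k] (θ : O →+* k)
    (hθ : Function.Surjective θ) :
    Set.range (Spec.map (CommRingCat.ofHom θ)) = {IsLocalRing.closedPoint O} := by
  have hpt : ∀ x : Spec (.of k), Spec.map (CommRingCat.ofHom θ) x = IsLocalRing.closedPoint O := by
    intro x
    rw [Spec.map_apply]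
    apply PrimeSpectrum.ext
    rw [PrimeSpectrum.comap_asIdeal, CommRingCat.hom_ofHom, Ideal.eq_bot_of_prime x.asIdeal, ← RingHom.ker_eq_comap_bot]
    exact IsLocalRing.eq_maximalIdeal (RingHom.ker_isMaximal_of_surjective θ hθ)
  ext s
  constructor
  · rintro ⟨x, rfl⟩; exact hpt x
  · rintro rfl
    exact ⟨(⊥ : PrimeSpectrum k), hpt _⟩

/-! ## The model step -/

/-- **THE MODEL STEP of T-ISO-0⁺** (see the module docstring). [cite: StacksProject, Tag 0805 with Tag 056P; Liu2002, Thm. 8.1.19] -/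
theorem modelStep (O : Type) [CommRing O] [IsLocalRing O] (k : Type) [Field k] (θ : O →+* k) (hθ : Function.Surjective θ)
    (P : Scheme.{0}) (q : P ⟶ Spec (.of O)) (Y : Set P)
    (Ch : ∀ X' : Scheme.{0}, (X' ⟶ P) → Set X' → Prop)
    (hStep : ∀ (X' X'' : Scheme.{0}) (σ' : X' ⟶ P) (S' : Set X') (C : X'.IdealSheafData) (τ : X'' ⟶ X'),
      Ch X' σ' S' → IsBlowup τ C → Scheme.IsRegular C.subscheme → Flat (C.subschemeι ≫ σ' ≫ q) →
      σ' '' (C.support : Set X') ⊆ {x : P | ¬ IsGenericPoint x Y} →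
      (C.support : Set X') ∩ (σ' ≫ q) ⁻¹' {IsLocalRing.closedPoint O} ⊆ S' →
      Ch X'' (τ ≫ σ') (closure (τ ⁻¹' (S' \ (C.support : Set X')))))
    -- the upstairs stage
    (X' : Scheme.{0}) (σ' : X' ⟶ P) (S' : Set X') (hCh : Ch X' σ' S')
    [IsLocallyNoetherian X'] (hreg : Scheme.IsRegular X')
    -- the downstairs stage and the model square
    (F : Scheme.{0}) (j : F ⟶ X') (t : F ⟶ Spec (.of k))
    (hsq : IsPullback j t (σ' ≫ q) (Spec.map (CommRingCat.ofHom θ)))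
    (T : Set F) (hTS : j '' T = S')
    -- the centres
    (C : X'.IdealSheafData) (D : F.IdealSheafData) (hCD : C.comap j = D)
    (hCreg : Scheme.IsRegular C.subscheme) (hCflat : Flat (C.subschemeι ≫ σ' ≫ q))
    (hoff : σ' '' (C.support : Set X') ⊆ {x : P | ¬ IsGenericPoint x Y})
    (hDT : (D.support : Set F) ⊆ T)
    -- the two blow-ups
    (X'' : Scheme.{0}) (τ : X'' ⟶ X') (hτ : IsBlowup τ C)
    (F₂ : Scheme.{0}) (υ : F₂ ⟶ F) (hυ : IsBlowup υ D) :
    Ch X'' (τ ≫ σ') (closure (τ ⁻¹' (S' \ (C.support : Set X')))) ∧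
    Scheme.IsRegular X'' ∧ IsLocallyNoetherian X'' ∧
    ∃ (j₂ : F₂ ⟶ X'') (t₂ : F₂ ⟶ Spec (.of k)),
      IsPullback j₂ t₂ ((τ ≫ σ') ≫ q) (Spec.map (CommRingCat.ofHom θ)) ∧ j₂ ≫ τ = υ ≫ j ∧
      j₂ '' closure (υ ⁻¹' (T \ (D.support : Set F))) = closure (τ ⁻¹' (S' \ (C.support : Set X'))) := by
  classical
  set r' : X' ⟶ Spec (.of O) := σ' ≫ q with hr'
  set s₀ := IsLocalRing.closedPoint O with hs₀
  -- `j` is a closed immersion onto the special fibre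
  haveI : IsClosedImmersion (Spec.map (CommRingCat.ofHom θ)) := IsClosedImmersion.spec_of_surjective _ hθ
  haveI hjci : IsClosedImmersion j := MorphismProperty.IsStableUnderBaseChange.of_isPullback hsq.flip inferInstance
  have hrangeθ := range_specMap_of_surjective_of_field θ hθ
  have hrangej : Set.range j = r' ⁻¹' {s₀} := by
    rw [range_eq_preimage_of_isPullback hsq, hrangeθ]
  -- E1: the special points of the centre lie on `S'`
  have hE1 : (C.support : Set X') ∩ (σ' ≫ q) ⁻¹' {s₀} ⊆ S' := by
    rintro x ⟨hxC, hxs⟩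
    obtain ⟨y, rfl⟩ : x ∈ Set.range j := by rw [hrangej]; exact hxs
    have hy : y ∈ (D.support : Set F) := by
      rw [← hCD, support_comap]
      exact hxC
    rw [← hTS]
    exact ⟨y, hDT hy, rfl⟩
  -- the new chain stage, regularity, Noetherianity
  have hCh'' : Ch X'' (τ ≫ σ') (closure (τ ⁻¹' (S' \ (C.support : Set X')))) :=
    hStep X' X'' σ' S' C τ hCh hτ hCreg hCflat hoff hE1
  haveI : IsProper τ := hτ.isProper
  have hnoeth'' : IsLocallyNoetherian X'' := LocallyOfFiniteType.isLocallyNoetherian τ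
  have hreg'' : Scheme.IsRegular X'' := hτ.isRegular_of_isRegular_subscheme hreg hCreg
  refine ⟨hCh'', hreg'', hnoeth'', ?_⟩
  -- the exceptional divisor of `τ` is flat over `O` (H1)
  haveI hflatE : Flat ((C.comap τ).subschemeι ≫ τ ≫ r') :=
    flat_exceptional_of_isBlowup_regularCentre O X' X'' r' C hreg hCreg hCflat τ hτ
  -- hence `X'' ×_{X'} F → F` is a blow-up along `C·𝒪_F = D`
  letI : Algebra O k := θ.toAlgebra
  have hsq' : IsPullback j t r' (specOfAlgebra O k) := hsq
  have hB : IsBlowup (pullback.snd τ j) (C.comap j) :=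
    hτ.of_isPullback_of_flat_exceptional k r' hsq' (IsPullback.of_hasPullback τ j)
  rw [hCD] at hB
  -- uniqueness of blow-ups: `F₂ ≅ X'' ×_{X'} F` over `F`
  obtain ⟨e, he, -⟩ := hυ.unique hB
  refine ⟨e.hom ≫ pullback.fst τ j, υ ≫ t, ?_, ?_, ?_⟩
  · -- the pasted square, moved along `e`
    have hbig : IsPullback (pullback.fst τ j) (pullback.snd τ j ≫ t) (τ ≫ r') (Spec.map (CommRingCat.ofHom θ)) :=
      (IsPullback.of_hasPullback τ j).paste_vert hsq
    refine hbig.of_iso e.symm (Iso.refl _) (Iso.refl _) (Iso.refl _) ?_ ?_ (by simp [hr']) (by simp)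
    · simp
    · simp only [Iso.symm_hom, Iso.refl_hom, Category.comp_id]
      rw [← he, Category.assoc, e.inv_hom_id_assoc]
  · rw [Category.assoc, pullback.condition, ← Category.assoc, he]
  · -- the strict-transform sets
    have hS'range : S' ⊆ Set.range j := by rw [← hTS]; exact Set.image_subset_range _ _
    have hpre : j ⁻¹' S' = T := by rw [← hTS, Set.preimage_image_eq _ hjci.isClosedEmbedding.injective]
    have hpreC : j ⁻¹' (C.support : Set X') = (D.support : Set F) := by
      rw [← hCD, support_comap]; rfl
    rw [closure_preimage_diff_eq_image_pullback τ j S' (C.support : Set X') hS'range, hpre, hpreC, Scheme.Hom.comp_base,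
      TopCat.coe_comp, Set.image_comp]
    congr 1
    have hsurj : Function.Surjective e.hom := e.hom.homeomorph.surjective
    have himg : e.hom '' (υ ⁻¹' (T \ (D.support : Set F))) = (pullback.snd τ j) ⁻¹' (T \ (D.support : Set F)) := by
      rw [← he, Scheme.Hom.comp_base, TopCat.coe_comp, Set.preimage_comp, Set.image_preimage_eq _ hsurj]
    rw [← himg]
    exact e.hom.homeomorph.image_closure _

end Summit.ResolutionOfSingularities.ResolutionOfSingularities.Cruxes.EquisingularLiftNat.Sections

end
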